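import Literature.NumberTheory.EllipticCurves.PastenSpectralDegreeIsogenyBoundProofs
import HarnessLib

/-!
# The Mazur–Kenku comparison in product form:
# `PastenShimura2024_minimalDegree_le_163_mul` ⇔ "the globally minimal model of every curve of the
# class carries a datum of degree `k · δ_{1,N}` with `1 ≤ k ≤ 163`"

A proofs-only companion (theorems only: no definition, no named fact, nothing restated) of
`PastenSpectralDegree.lean` and `PastenSpectralDegreeIsogenyBoundProofs.lean`.

The named fact `PastenShimura2024_minimalDegree_le_163_mul` (Pasten 2024, §3 p. 13: *"The degree
of a minimal isogeny between `A_{1,N}` and `E` is uniformly bounded by `163` thanks to Mazur and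
Kenku"*) is recorded in SIZE form — the minimal parametrisation degree of a globally minimal `W'`
of the class is `≤ 163 · δ_{1,N}` — which by itself says nothing about the prime factors of the
degrees of the data of `W'`. What the printed sentence gives is the PRODUCT form: composing the
optimal parametrisation `X₀(N) → A_{1,N}` (degree `δ_{1,N}`) with a minimal, hence cyclic,
`ℚ`-isogeny `ψ₀ : A_{1,N} → E` (degree `≤ 163`, Mazur 1978, Thm. 1; Kenku 1982) is a
parametrisation of the globally minimal model of `E` of degree exactly `deg ψ₀ · δ_{1,N}`, so that
every prime factor of that degree divides `δ_{1,N}` or is `≤ 163`.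

Over the tree the two forms are **equivalent**, with no hypothesis
(`PastenShimura2024_minimalDegree_le_163_mul_iff_exists_datum_modularDegree_eq_mul`):

* `ModularParametrizationData.exists_datum_modularDegree_eq_mul_of_natCard_ker_le` — the
  algebraic core: if `D₀` has minimal degree among all data at level `N` with its newform `f`, `D₁`
  is a datum of `W` with newform `f`, and `k ≠ 0` is an integer with `k Λ_f ⊆ Λ_W` whose isogeny
  `z ↦ k z : ℂ/Λ_f → ℂ/Λ_W` has kernel of order `≤ B`, then `W` carries a datum with newform `f` of
  degree `m · deg φ_{D₀}`, `1 ≤ m ≤ B`. Indeed `D₀` is optimal, `c₀ Λ_f = Λ_{E₀}`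
  (`latticeEq_of_modularDegree_le` against the unconditional optimal datum of
  `exists_optimalDatum'`), the datum of `W` with Manin constant `k` exists (`exists_datum_c_eq`),
  and its degree is `#ker(z ↦ k z) · deg φ_{D₀}` (`modularDegree_eq_card_ker_mul`);
* `PastenShimura2024_exists_datum_modularDegree_eq_mul_of` — size form ⇒ product form, through
  the Néron-lattice form `hMK` of the size form (`PastenShimura2024_minimalDegree_le_163_mul_iff`,
  unconditional) at the given datum of `W`;
* the converse is immediate (`deg D' ≤ deg D'' = k · δ ≤ 163 · δ`).

Consumer: crux `DegreePrimesPolyBounded` of summit ABC (primes dividing the modular degree of a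
semistable curve), whose Mazur–Kenku step is the product form.

## References

* H. Pasten, *Shimura curves and the abc conjecture*, J. Number Theory 254 (2024), 214–335 =
  arXiv:1705.09251: §3, p. 13. [PastenShimura2024]
* B. Mazur, *Rational isogenies of prime degree*, Invent. Math. 44 (1978), 129–162: Thm. 1.
  [Mazur1978]
* M. A. Kenku, *On the number of `ℚ`-isomorphism classes of elliptic curves in each `ℚ`-isogeny
  class*, J. Number Theory 15 (1982), 199–202. [Kenku1982]
* A. W. Knapp, *Elliptic curves*, Math. Notes 40, Princeton 1993: Prop. 12.9(a), p. 302
  (optimal parametrisation and its homological characterisation). [Knapp1993]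
* J. H. Silverman, *The Arithmetic of Elliptic Curves*, 2nd ed., GTM 106 (2009): Thm. VI.4.1
  (isogenies of complex tori `z ↦ α z`, degree `[Λ₂ : α Λ₁]`). [SilvermanAEC2009]
-/

noncomputable section

open scoped MatrixGroups ModularForm

open CongruenceSubgroup

namespace Literature.NumberTheory.EllipticCurves.ModularForms

namespace ModularParametrizationData

/-- **Product form from the Néron-lattice form at one datum.** Let `D₀` be a datum (of an elliptic
`W₀/ℚ`, level `N`) of minimal degree among all data at level `N`, of all elliptic `W'/ℚ`, with the
newform `f = D₀.f` (so `deg φ_{D₀} = δ_{1,N}`), let `D₁` be a datum of `W` with newform `f`, and let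
`k ≠ 0` be an integer with `k Λ_f ⊆ Λ_W` such that `z ↦ k z : ℂ/Λ_f → ℂ/Λ_W` has kernel of order
`≤ B`. Then `W` carries a datum `D` with newform `f` and `deg φ_D = m · deg φ_{D₀}`, `1 ≤ m ≤ B`
(`m = [Λ_W : k Λ_f]`): `D₀` is optimal, `c₀ Λ_f = Λ_{E₀}` (`latticeEq_of_modularDegree_le` against
the optimal datum of `exists_optimalDatum'`; Knapp 1993, Prop. 12.9(a)), the datum of `W` with
Manin constant `k` exists (`exists_datum_c_eq`), and its degree is `#ker(z ↦ k z) · deg φ_{D₀}`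
(`modularDegree_eq_card_ker_mul`; degrees multiply, `deg [z ↦ k z] = [Λ_W : k Λ_f]`, Silverman
AEC VI.4.1). [cite: SilvermanAEC2009, Thm. VI.4.1] -/
theorem exists_datum_modularDegree_eq_mul_of_natCard_ker_le
    {N : ℕ} [NeZero N] {W₀ W : WeierstrassCurve ℚ} [W₀.IsElliptic]
    (D₀ : ModularParametrizationData W₀ N) (D₁ : ModularParametrizationData W N)
    (hf : D₁.f = D₀.f)
    (hmin : ∀ (W' : WeierstrassCurve ℚ) [W'.IsElliptic] (D' : ModularParametrizationData W' N),
      D'.f = D₀.f → D₀.modularDegree ≤ D'.modularDegree)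
    {B : ℕ} {k : ℤ} (hk : ∀ z ∈ periodLattice D₁.f, (k : ℂ) * z ∈ D₁.L.lattice) (hk0 : k ≠ 0)
    (hkB : Nat.card
      (mulQuotientMap (periodLattice D₁.f) D₁.L.lattice.toAddSubgroup (k : ℂ) hk).ker ≤ B) :
    ∃ (D : ModularParametrizationData W N) (m : ℕ),
      D.f = D₀.f ∧ 0 < m ∧ m ≤ B ∧ D.modularDegree = m * D₀.modularDegree := by
  -- `D₀` is optimal: `Λ_{E₀} = c₀ Λ_f`
  obtain ⟨W₂, hW₂, D₂, hf₂, h₂⟩ := D₀.exists_optimalDatum'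
  haveI := hW₂
  have hopt : ∀ z ∈ D₀.L.lattice, ∃ w ∈ periodLattice D₀.f, z = D₀.c * w :=
    D₀.latticeEq_of_modularDegree_le D₂ hf₂ h₂ (hmin W₂ D₂ hf₂)
  have hinj : Function.Injective D₀.isogenyMap :=
    (AddMonoidHom.ker_eq_bot_iff _).mp (D₀.isogenyMap_ker_eq_bot_iff.mpr hopt)
  -- the datum of `W` with Manin constant `k`, of degree `#ker · deg D₀`
  obtain ⟨D, hfD, hLD, -, rfl⟩ := D₁.exists_datum_c_eq hk0 hk
  obtain ⟨hfin, hdeg⟩ := D.modularDegree_eq_card_ker_mul (hfD.trans hf) D₀.smul_periodLattice_le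
    hinj D₀.deg_pos D₀.finite_setOf_natCard_fiberOrbits_ne
  haveI := hfin
  refine ⟨D, Nat.card D.isogenyMap.ker, hfD.trans hf, Nat.card_pos, ?_, hdeg⟩
  have hΛ : D.L.lattice.toAddSubgroup = D₁.L.lattice.toAddSubgroup := by rw [hLD]
  calc Nat.card D.isogenyMap.ker
      = Nat.card (mulQuotientMap (periodLattice D₁.f) D₁.L.lattice.toAddSubgroup (D.c : ℂ) hk).ker :=
        natCard_ker_mulQuotientMap_congr (congrArg periodLattice hfD) hΛ D.smul_periodLattice_le hk
    _ ≤ B := hkB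

end ModularParametrizationData

/-! ### Size form ⇔ product form -/

/-- **The product form of the Mazur–Kenku comparison from the size form.** Assume
`PastenShimura2024_minimalDegree_le_163_mul`. If `D₀` is a datum of minimal degree among all data at
level `N` with its newform (`deg φ_{D₀} = δ_{1,N}`) and the GLOBALLY MINIMAL elliptic `W` carries
some datum `D₁` with the same newform (i.e. `W` is the minimal model of a curve of the class), then
`W` carries a datum with the same newform of degree `k · deg φ_{D₀}` with `1 ≤ k ≤ 163` — the
optimal parametrisation followed by a minimal (cyclic) isogeny `A_{1,N} → E`, of degree `≤ 163`
(Pasten 2024, §3 p. 13, from Mazur 1978, Thm. 1 and Kenku 1982). Proof: the size form is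
equivalent to its Néron-lattice form (`PastenShimura2024_minimalDegree_le_163_mul_iff`: an integer
`k ≠ 0` with `k Λ_f ⊆ Λ_W` and `#ker(z ↦ k z) ≤ 163`), applied at `D₁`, and
`exists_datum_modularDegree_eq_mul_of_natCard_ker_le`. [cite: PastenShimura2024, §3 p. 13]
[cite: Mazur1978, Thm. 1] [cite: Kenku1982] -/
theorem PastenShimura2024_exists_datum_modularDegree_eq_mul_of
    (h : PastenShimura2024_minimalDegree_le_163_mul) :
    ∀ (N : ℕ) [NeZero N] (W₀ W : WeierstrassCurve ℚ) [W₀.IsElliptic] [W.IsElliptic]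
      [W.IsGloballyMinimal] (D₀ : ModularParametrizationData W₀ N)
      (D₁ : ModularParametrizationData W N), D₁.f = D₀.f →
      (∀ (W' : WeierstrassCurve ℚ) [W'.IsElliptic] (D' : ModularParametrizationData W' N),
          D'.f = D₀.f → D₀.modularDegree ≤ D'.modularDegree) →
      ∃ (D : ModularParametrizationData W N) (k : ℕ),
        D.f = D₀.f ∧ 0 < k ∧ k ≤ 163 ∧ D.modularDegree = k * D₀.modularDegree := by
  intro N _ W₀ W _ _ _ D₀ D₁ hf hmin
  obtain ⟨k, hk, hk0, hk163⟩ := PastenShimura2024_minimalDegree_le_163_mul_iff.mp h D₁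
  exact D₀.exists_datum_modularDegree_eq_mul_of_natCard_ker_le D₁ hf hmin hk hk0 hk163

/-- **Size form ⇔ product form, unconditionally.** `PastenShimura2024_minimalDegree_le_163_mul`
holds iff for every class-minimal datum `D₀` at level `N` and every globally minimal elliptic `W`
carrying a datum with the same newform, `W` carries a datum with the same newform of degree
`k · deg φ_{D₀}`, `1 ≤ k ≤ 163`. `→` is `PastenShimura2024_exists_datum_modularDegree_eq_mul_of`;
`←`: for `D'` minimal among the data of the globally minimal `W'`, `deg D' ≤ deg D'' = k · deg D
≤ 163 · deg D` with the datum `D''` of the product form (Pasten 2024, §3 p. 13).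
[cite: PastenShimura2024, §3 p. 13] -/
theorem PastenShimura2024_minimalDegree_le_163_mul_iff_exists_datum_modularDegree_eq_mul :
    PastenShimura2024_minimalDegree_le_163_mul ↔
    ∀ (N : ℕ) [NeZero N] (W₀ W : WeierstrassCurve ℚ) [W₀.IsElliptic] [W.IsElliptic]
      [W.IsGloballyMinimal] (D₀ : ModularParametrizationData W₀ N)
      (D₁ : ModularParametrizationData W N), D₁.f = D₀.f →
      (∀ (W' : WeierstrassCurve ℚ) [W'.IsElliptic] (D' : ModularParametrizationData W' N),
          D'.f = D₀.f → D₀.modularDegree ≤ D'.modularDegree) →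
      ∃ (D : ModularParametrizationData W N) (k : ℕ),
        D.f = D₀.f ∧ 0 < k ∧ k ≤ 163 ∧ D.modularDegree = k * D₀.modularDegree := by
  refine ⟨PastenShimura2024_exists_datum_modularDegree_eq_mul_of,
    fun h N _ W W' _ _ _ D D' hf hmin hmin' ↦ ?_⟩
  obtain ⟨D'', k, -, -, hk, hdeg⟩ := h N W W' D D' hf hmin
  calc D'.modularDegree ≤ D''.modularDegree := hmin' D''
    _ = k * D.modularDegree := hdeg
    _ ≤ 163 * D.modularDegree := Nat.mul_le_mul_right _ hk

end Literature.NumberTheory.EllipticCurves.ModularForms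

end
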